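import Summits.QuantumFields.QCD.Theorems.HeatSlicedQuarksRobustYangMillsHandoverStubProjChainDetHasDerivAtSource
import HarnessLib

/-!
# Stub `stub_projChain_det_two_sources` of line `pin-the-infimum` (crux `RobustYangMillsHandover`, 8892)

E2, layer F4-a (wave 4) of the fermionic-insertion bricks in Lüscher's transfer-matrix representation of
the QCD torus functional: **two sources at distinct time slices of a Wilson-type projector chain with
general slice operators.**  The numerator of a meson two-point function carries two quark bilinears,
`(ψ̄J₁ψ)_{t₁}` and `(ψ̄J₂ψ)_{t₂}` with `t₁ ≠ t₂`; by the Berezin source identity it is the mixed second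
derivative `∂_{s₁}|₀ ∂_{s₂}|₀` of the fermion determinant of the chain whose slice operators are
`A_{t₁} − s₁J₁` at `t₁` and `A_{t₂} − s₂J₂` at `t₂`.  This file proves the corresponding formula in the
shape `HasDerivAt (s₁ ↦ deriv (s₂ ↦ det D(s₁, s₂)) 0) (…) 0`:

  `∂_{s₁}|₀ ∂_{s₂}|₀ det D(s₁, s₂) = (∏_t det E_t) · STr ∏_{i<T} (𝒥¹_i 𝒥²_i Γ(N_i))`,

`E_t = A_tP⁻ − P⁺W′_{t−1}`, `F_t = A_tP⁺ − P⁻W_t`, `N_t = −E_t⁻¹F_t`, with the one-slice insertions of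
layer F1, `𝒥ᵏ_i = 1` for `i ≠ t_k` and `𝒥ᵏ_{t_k} = dΓ(E⁻¹J_k(P⁻ − P⁺F⁻¹E)) − tr (E⁻¹J_kP⁻) · 1`
(`E = E_{t_k}`, `F = F_{t_k}`), all one-particle matrices carried to the Fock index `Fin d` by
`Matrix.reindex e e`.

## Proof

The one-slice formula `stub_projChain_det_hasDerivAt_source` (F1) holds for GENERAL slice operators, so
it applies to the `t₁`-perturbed data `A^{(s₁)}_t = A_t − [t = t₁] s₁J₁` with the source `J₂` at `t₂`:
for every `s₁` near `0` (where `E_{t₁}(s₁) = E_{t₁} − s₁J₁P⁻` stays invertible,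
`StubMatrixAffinePathCalculus.eventually_isUnit_det_sub_smul`) the inner function is differentiable at
`s₂ = 0` with derivative `(∏_t det E_t(s₁)) · STr ∏_i (𝒥²_i Γ(N_i(s₁)))`; since `t₁ ≠ t₂` the
insertion `𝒥²` only involves the unperturbed slice-`t₂` data, and only the factors at `t₁` depend on
`s₁`.  Hence `s₁ ↦ deriv (…) 0` agrees near `0` with the product of the scalar path
`C · det (E_{t₁} − s₁J₁P⁻)` (Jacobi's formula) and the supertrace of an ordered product with ONE moving
factor `Γ(N_{t₁}(s₁))` (`StubOneStepPathHasDerivAt`, `StubGammaPathHasDerivAt`,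
`StubSupertraceProdHasDerivAt`, the constant factor at `t₂` being `𝒥² Γ(N_{t₂})`), and the two terms of
the product rule recombine in the slot `t₁` by two-sided linearity of the ordered product, exactly as in
layer F1 (`StubProjChainDetHasDerivAtSource`).

References: M. Lüscher, *Construction of a selfadjoint, strictly positive transfer matrix for
Euclidean lattice gauge theories*, Comm. Math. Phys. 54 (1977) 283, pp. 283–292 [Luscher1977];
I. Montvay, G. Münster, *Quantum Fields on a Lattice*, §4.2.3 and §7.1 (meson correlators as
derivatives of the fermion determinant); J. Smit, *Introduction to Quantum Fields on a Lattice*,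
§6.5, App. C.  Pure theorem file (no definitions).
-/

open Matrix Literature.MathematicalPhysics.QuantumLattice Literature.MathematicalPhysics.QuantumFieldTheory

namespace Summit.QuantumFields.QCD.Cruxes.RobustYangMillsHandover.PinTheInfimum

open Summit.QuantumFields.QCD.Cruxes.StableActionBridge.Sketch

namespace StubProjChainDetTwoSources

/-- **The `ℕ`/`ZMod T` slot dictionary**: for `i < T`, `(i : ZMod T) = t ↔ i = t.val`. [folklore] -/
theorem natCast_eq_iff {T : ℕ} [NeZero T] {i : ℕ} (hi : i < T) (t : ZMod T) :
    (i : ZMod T) = t ↔ i = t.val :=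
  ⟨fun h => by rw [← h, ZMod.val_natCast_of_lt hi], fun h => by rw [h, ZMod.natCast_zmod_val]⟩

/-- **A slot factor absent at `t₁`**: for `t₁ ≠ t₂` the `t₂`-insertion slot is trivial at the index
`t₁.val`, `(if (t₁.val : ZMod T) = t₂ then I else 1) * M = M`. [folklore] -/
theorem ite_natCast_val_mul {T : ℕ} [NeZero T] {t₁ t₂ : ZMod T} (h : t₁ ≠ t₂) {α : Type*}
    [MulOneClass α] (I M : α) :
    (if ((t₁.val : ℕ) : ZMod T) = t₂ then I else 1) * M = M := by
  rw [ZMod.natCast_zmod_val, if_neg h, one_mul]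

end StubProjChainDetTwoSources

open StubProjChainDetHasDerivAtSource StubProjChainDetTwoSources in
/-- **E2 F4-a: the mixed second source derivative of a projector-chain determinant, two sources at
distinct slices** (general slice operators; registered stub signature verbatim).  For a `T`-slice
Wilson-type projector chain on `X × Fin N × Fin 4` with slice operators `A_t`, hops `W_t, W′_t`
commuting with the lifted time projections `P± = 1 ⊗ 1 ⊗ ½(1 ± γ₀)`, all `E_t = A_tP⁻ − P⁺W′_{t−1}`
invertible, `F_{t₁}`, `F_{t₂}` invertible (`F_t = A_tP⁺ − P⁻W_t`) and `t₁ ≠ t₂`, the determinant of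
the chain with slice operators `A_{t₁} − s₁J₁`, `A_{t₂} − s₂J₂` satisfies
`∂_{s₁}|₀ ∂_{s₂}|₀ det D = (∏_t det E_t) · STr ∏_{i<T} (𝒥¹_i 𝒥²_i Γ(N_i))`, `N_i = −E_i⁻¹F_i`,
`𝒥ᵏ_i = 1` (`i ≠ t_k`), `𝒥ᵏ_{t_k} = dΓ(E⁻¹J_k(P⁻ − P⁺F⁻¹E)) − tr (E⁻¹J_kP⁻) · 1` — the one-slice
formula (layer F1) iterated: applied to the `t₁`-perturbed slice operators with the source at `t₂`,
then differentiated in `s₁` (module docstring). [cite: Luscher1977, pp. 283–292] -/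
theorem stub_projChain_det_two_sources :
    ∀ (T : ℕ) [NeZero T] (X : Type) [Fintype X] [DecidableEq X] (N d : ℕ) (e : X × Fin N × Fin 4 ≃ Fin d)
      (A W W' : ZMod T → Matrix (X × Fin N × Fin 4) (X × Fin N × Fin 4) ℂ) (t₁ t₂ : ZMod T)
      (J₁ J₂ : Matrix (X × Fin N × Fin 4) (X × Fin N × Fin 4) ℂ),
      let Pp : Matrix (X × Fin N × Fin 4) (X × Fin N × Fin 4) ℂ := Matrix.of fun a b =>
        if a.1 = b.1 ∧ a.2.1 = b.2.1 then ((1 / 2 : ℂ) • (1 + euclideanGamma 0)) a.2.2 b.2.2 else 0;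
      let Pm : Matrix (X × Fin N × Fin 4) (X × Fin N × Fin 4) ℂ := Matrix.of fun a b =>
        if a.1 = b.1 ∧ a.2.1 = b.2.1 then ((1 / 2 : ℂ) • (1 - euclideanGamma 0)) a.2.2 b.2.2 else 0;
      (∀ t, W t * Pp = Pp * W t) → (∀ t, W t * Pm = Pm * W t) →
      (∀ t, W' t * Pp = Pp * W' t) → (∀ t, W' t * Pm = Pm * W' t) →
      (∀ t, IsUnit (A t * Pm - Pp * W' (t - 1)).det) →
      IsUnit (A t₁ * Pp - Pm * W t₁).det → IsUnit (A t₂ * Pp - Pm * W t₂).det → t₁ ≠ t₂ →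
      HasDerivAt (fun s₁ : ℝ => deriv (fun s₂ : ℝ => (Matrix.of fun p q : ZMod T × (X × Fin N × Fin 4) =>
          (if q.1 = p.1 then
              (A p.1 - (if p.1 = t₁ then (s₁ : ℂ) • J₁ else 0) - (if p.1 = t₂ then (s₂ : ℂ) • J₂ else 0)) p.2 q.2
            else 0) -
            (if q.1 = p.1 + 1 then (Pm * W p.1) p.2 q.2 else 0) -
            (if p.1 = q.1 + 1 then (Pp * W' q.1) p.2 q.2 else 0)).det) 0)
        ((∏ t, (A t * Pm - Pp * W' (t - 1)).det) *
          ∑ S : Finset (Fin d), (-1 : ℂ) ^ S.card *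
            (((List.range T).map fun i : ℕ =>
              (if (i : ZMod T) = t₁ then
                  dGamma (Matrix.reindex e e ((A t₁ * Pm - Pp * W' (t₁ - 1))⁻¹ * J₁ *
                    (Pm - Pp * (A t₁ * Pp - Pm * W t₁)⁻¹ * (A t₁ * Pm - Pp * W' (t₁ - 1))))) -
                  ((A t₁ * Pm - Pp * W' (t₁ - 1))⁻¹ * J₁ * Pm).trace • (1 : Matrix (Finset (Fin d)) (Finset (Fin d)) ℂ)
                else 1) *
              ((if (i : ZMod T) = t₂ then
                  dGamma (Matrix.reindex e e ((A t₂ * Pm - Pp * W' (t₂ - 1))⁻¹ * J₂ *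
                    (Pm - Pp * (A t₂ * Pp - Pm * W t₂)⁻¹ * (A t₂ * Pm - Pp * W' (t₂ - 1))))) -
                  ((A t₂ * Pm - Pp * W' (t₂ - 1))⁻¹ * J₂ * Pm).trace • (1 : Matrix (Finset (Fin d)) (Finset (Fin d)) ℂ)
                else 1) *
              fockLift (Matrix.reindex e e (-((A (i : ZMod T) * Pm - Pp * W' ((i : ZMod T) - 1))⁻¹ *
                (A (i : ZMod T) * Pp - Pm * W (i : ZMod T))))))).prod) S S) 0 := by
  intro T _ X _ _ N d e A W W' t₁ t₂ J₁ J₂ Pp Pm hWp hWm hW'p hW'm hE hF₁ hF₂ h12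
  -- the two projections as explicit matrices (to fold the output of layer F1)
  have hPp : Pp = Matrix.of fun a b : X × Fin N × Fin 4 =>
      if a.1 = b.1 ∧ a.2.1 = b.2.1 then ((1 / 2 : ℂ) • (1 + euclideanGamma 0)) a.2.2 b.2.2 else 0 := rfl
  have hPm : Pm = Matrix.of fun a b : X × Fin N × Fin 4 =>
      if a.1 = b.1 ∧ a.2.1 = b.2.1 then ((1 / 2 : ℂ) • (1 - euclideanGamma 0)) a.2.2 b.2.2 else 0 := rfl
  -- the two slots
  have ht₁T : t₁.val < T := ZMod.val_lt t₁
  have h21 : ¬t₂ = t₁ := fun h => h12 h.symm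
  -- notation: the `t₁` blocks, the `t₁` insertion data, the `t₂` insertion, the unperturbed factors
  set E₁ : Matrix (X × Fin N × Fin 4) (X × Fin N × Fin 4) ℂ := A t₁ * Pm - Pp * W' (t₁ - 1)
  set F₁ : Matrix (X × Fin N × Fin 4) (X × Fin N × Fin 4) ℂ := A t₁ * Pp - Pm * W t₁
  set Z : Matrix (X × Fin N × Fin 4) (X × Fin N × Fin 4) ℂ := E₁⁻¹ * J₁ * (Pm - Pp * F₁⁻¹ * E₁) with hZ
  set c : ℂ := (E₁⁻¹ * J₁ * Pm).trace with hc
  set I₂ : Matrix (Finset (Fin d)) (Finset (Fin d)) ℂ :=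
    dGamma (Matrix.reindex e e ((A t₂ * Pm - Pp * W' (t₂ - 1))⁻¹ * J₂ *
      (Pm - Pp * (A t₂ * Pp - Pm * W t₂)⁻¹ * (A t₂ * Pm - Pp * W' (t₂ - 1))))) -
    ((A t₂ * Pm - Pp * W' (t₂ - 1))⁻¹ * J₂ * Pm).trace • (1 : Matrix (Finset (Fin d)) (Finset (Fin d)) ℂ)
    with hI₂
  set C : ℂ := ∏ t ∈ Finset.univ.erase t₁, (A t * Pm - Pp * W' (t - 1)).det
  set Mf : ℕ → Matrix (Finset (Fin d)) (Finset (Fin d)) ℂ := fun i =>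
    Gamma (Matrix.reindex e e (-((A (i : ZMod T) * Pm - Pp * W' ((i : ZMod T) - 1))⁻¹ *
      (A (i : ZMod T) * Pp - Pm * W (i : ZMod T)))))
  set M₂ : ℕ → Matrix (Finset (Fin d)) (Finset (Fin d)) ℂ := fun i =>
    (if (i : ZMod T) = t₂ then I₂ else 1) * Mf i
  set γ : ℝ → Matrix (Finset (Fin d)) (Finset (Fin d)) ℂ := fun s =>
    Gamma (Matrix.reindex e e (-((E₁ - (s : ℂ) • (J₁ * Pm))⁻¹ * (F₁ - (s : ℂ) • (J₁ * Pp)))))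
  have hE₁u : IsUnit E₁.det := hE t₁
  have hMf' : ∀ i : ℕ, Gamma (Matrix.reindex e e (-((A (i : ZMod T) * Pm - Pp * W' ((i : ZMod T) - 1))⁻¹ *
      (A (i : ZMod T) * Pp - Pm * W (i : ZMod T))))) = Mf i := fun i => rfl
  have hM₂t₁ : M₂ t₁.val = Mf t₁.val := ite_natCast_val_mul h12 I₂ (Mf t₁.val)
  have hPE : C * E₁.det = ∏ t, (A t * Pm - Pp * W' (t - 1)).det :=
    Finset.prod_erase_mul Finset.univ (fun t => (A t * Pm - Pp * W' (t - 1)).det) (Finset.mem_univ t₁)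
  have htr : (E₁⁻¹ * (J₁ * Pm)).trace = c := by rw [hc, Matrix.mul_assoc]
  -- the perturbed `t₁` blocks are affine paths; the slice `t₂` is unperturbed by the `t₁` source
  have hpE : ∀ s : ℝ, (A t₁ - (s : ℂ) • J₁) * Pm - Pp * W' (t₁ - 1) = E₁ - (s : ℂ) • (J₁ * Pm) := fun s => by
    rw [Matrix.sub_mul, Matrix.smul_mul, sub_right_comm]
  have hpF : ∀ s : ℝ, (A t₁ - (s : ℂ) • J₁) * Pp - Pm * W t₁ = F₁ - (s : ℂ) • (J₁ * Pp) := fun s => by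
    rw [Matrix.sub_mul, Matrix.smul_mul, sub_right_comm]
  have hA₂ : ∀ s : ℝ, (A t₂ - if t₂ = t₁ then (s : ℂ) • J₁ else 0) = A t₂ := fun s => by
    rw [if_neg h21, sub_zero]
  have hF₂' : ∀ s : ℝ, IsUnit (((A t₂ - if t₂ = t₁ then (s : ℂ) • J₁ else 0) * Pp - Pm * W t₂).det) :=
    fun s => by rw [hA₂]; exact hF₂
  -- near `s = 0` every perturbed `E`-block is invertible
  have hEall : ∀ s : ℝ, IsUnit (E₁ - (s : ℂ) • (J₁ * Pm)).det →
      ∀ t, IsUnit (((A t - if t = t₁ then (s : ℂ) • J₁ else 0) * Pm - Pp * W' (t - 1)).det) := by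
    intro s hs t
    by_cases ht : t = t₁
    · rw [if_pos ht, ht, hpE]
      exact hs
    · rw [if_neg ht, sub_zero]
      exact hE t
  -- the first factor of `det_projChain` along the `t₁` path
  have hprod : ∀ s : ℝ, (∏ t, ((A t - if t = t₁ then (s : ℂ) • J₁ else 0) * Pm - Pp * W' (t - 1)).det) =
      C * (E₁ - (s : ℂ) • (J₁ * Pm)).det := fun s => by
    rw [← Finset.prod_erase_mul _ _ (Finset.mem_univ t₁), if_pos rfl, hpE]
    congr 1
    exact Finset.prod_congr rfl fun t ht => by rw [if_neg (Finset.ne_of_mem_erase ht), sub_zero]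
  -- the one-step factors along the `t₁` path, dressed with the `t₂` insertion: only the slot `t₁.val` moves
  have hlist : ∀ s : ℝ, ((List.range T).map fun i : ℕ =>
      (if (i : ZMod T) = t₂ then I₂ else 1) *
        fockLift (Matrix.reindex e e
          (-(((A (i : ZMod T) - if (i : ZMod T) = t₁ then (s : ℂ) • J₁ else 0) * Pm - Pp * W' ((i : ZMod T) - 1))⁻¹ *
            ((A (i : ZMod T) - if (i : ZMod T) = t₁ then (s : ℂ) • J₁ else 0) * Pp - Pm * W (i : ZMod T)))))) =
      (List.range T).map fun i => if i = t₁.val then γ s else M₂ i := fun s => by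
    refine List.map_congr_left fun i hi => ?_
    rw [List.mem_range] at hi
    rw [FockLiftPosDef.fockLift_eq_Gamma']
    by_cases h : i = t₁.val
    · rw [if_pos h, if_pos ((natCast_eq_iff hi t₁).2 h), (natCast_eq_iff hi t₁).2 h, if_neg h12,
        Matrix.one_mul, hpE, hpF]
    · rw [if_neg h, if_neg (mt (natCast_eq_iff hi t₁).1 h), sub_zero]
  -- layer F1 at the source `J₂`, slice `t₂`, for the `t₁`-perturbed slice operators
  have key : ∀ s : ℝ, IsUnit (E₁ - (s : ℂ) • (J₁ * Pm)).det →
      HasDerivAt (fun s₂ : ℝ => (Matrix.of fun p q : ZMod T × (X × Fin N × Fin 4) =>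
          (if q.1 = p.1 then
              (A p.1 - (if p.1 = t₁ then (s : ℂ) • J₁ else 0) - (if p.1 = t₂ then (s₂ : ℂ) • J₂ else 0)) p.2 q.2
            else 0) -
            (if q.1 = p.1 + 1 then (Pm * W p.1) p.2 q.2 else 0) -
            (if p.1 = q.1 + 1 then (Pp * W' q.1) p.2 q.2 else 0)).det)
        (C * (E₁ - (s : ℂ) • (J₁ * Pm)).det *
          ∑ S : Finset (Fin d), (-1 : ℂ) ^ S.card *
            ((List.range T).map fun i : ℕ => if i = t₁.val then γ s else M₂ i).prod S S) 0 := by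
    intro s hs
    have h := stub_projChain_det_hasDerivAt_source T X N d e (fun t => A t - if t = t₁ then (s : ℂ) • J₁ else 0)
      W W' t₂ J₂ hWp hWm hW'p hW'm (hEall s hs) (hF₂' s)
    beta_reduce at h
    rw [← hPp, ← hPm] at h
    rw [hA₂ s, ← hI₂, hprod s, hlist s] at h
    exact h
  -- the value and the derivative of the moving factor at `s = 0`
  have hM0 : -((E₁ - ((0 : ℝ) : ℂ) • (J₁ * Pm))⁻¹ * (F₁ - ((0 : ℝ) : ℂ) • (J₁ * Pp))) = -(E₁⁻¹ * F₁) := by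
    rw [Complex.ofReal_zero, zero_smul, zero_smul, sub_zero, sub_zero]
  have hMf0 : Mf t₁.val = Gamma (Matrix.reindex e e (-(E₁⁻¹ * F₁))) := by
    rw [← hMf', ZMod.natCast_zmod_val]
  have hγ0 : γ 0 = Mf t₁.val := by
    rw [hMf0]
    exact congrArg (fun M => Gamma (Matrix.reindex e e M)) hM0
  have hγ0' : γ 0 = M₂ t₁.val := hγ0.trans hM₂t₁.symm
  have hZ' : (-(E₁⁻¹ * (J₁ * Pm) * E₁⁻¹ * F₁) + E₁⁻¹ * (J₁ * Pp)) * (-(E₁⁻¹ * F₁))⁻¹ = Z := by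
    rw [deriv_mul_inv_oneStep hE₁u hF₁, hZ, Matrix.mul_sub (E₁⁻¹ * J₁) Pm (Pp * F₁⁻¹ * E₁),
      Matrix.mul_assoc E₁⁻¹ J₁ Pm, Matrix.mul_assoc E₁⁻¹ J₁ (Pp * F₁⁻¹ * E₁), Matrix.mul_assoc Pp F₁⁻¹ E₁,
      Matrix.mul_assoc (E₁⁻¹ * (J₁ * Pp)) F₁⁻¹ E₁, Matrix.mul_assoc E₁⁻¹ (J₁ * Pp) (F₁⁻¹ * E₁),
      Matrix.mul_assoc J₁ Pp (F₁⁻¹ * E₁)]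
  have hγ₁ : ∀ a b, HasDerivAt
      (fun s : ℝ => Matrix.reindex e e (-((E₁ - (s : ℂ) • (J₁ * Pm))⁻¹ * (F₁ - (s : ℂ) • (J₁ * Pp)))) a b)
      (Matrix.reindex e e (-(E₁⁻¹ * (J₁ * Pm) * E₁⁻¹ * F₁) + E₁⁻¹ * (J₁ * Pp)) a b) 0 := fun a b =>
    StubOneStepPathHasDerivAt.hasDerivAt_neg_inv_mul_apply F₁ (J₁ * Pm) (J₁ * Pp) hE₁u (e.symm a) (e.symm b)
  have hdet0 : IsUnit (Matrix.reindex e e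
      (-((E₁ - ((0 : ℝ) : ℂ) • (J₁ * Pm))⁻¹ * (F₁ - ((0 : ℝ) : ℂ) • (J₁ * Pp))))).det := by
    rw [hM0, Matrix.det_reindex_self]
    exact isUnit_det_neg_inv_mul hE₁u hF₁
  have hγ' : ∀ S S', HasDerivAt (fun s => γ s S S') ((dGamma (Matrix.reindex e e Z) * Mf t₁.val) S S') 0 := by
    intro S S'
    have h := StubGammaPathHasDerivAt.hasDerivAt_Gamma_apply_right hγ₁ hdet0 S S'
    rw [hM0, Matrix.inv_reindex, ← FermionSliceOpCovariance.reindex_mul_reindex, hZ', ← hMf0] at h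
    exact h
  -- the two scalar paths and their product
  have hP' : HasDerivAt (fun s : ℝ => C * (E₁ - (s : ℂ) • (J₁ * Pm)).det)
      (C * -(E₁.det * (E₁⁻¹ * (J₁ * Pm)).trace)) 0 :=
    (StubMatrixAffinePathCalculus.hasDerivAt_det_sub_smul (J₁ * Pm) hE₁u).const_mul C
  have hQ' := (stub_supertrace_prod_hasDerivAt (Fin d) T t₁.val M₂ γ
    (dGamma (Matrix.reindex e e Z) * Mf t₁.val) 0 hγ' hγ0' ht₁T).2.2
  have hev : ∀ᶠ s : ℝ in nhds 0, IsUnit (E₁ - (s : ℂ) • (J₁ * Pm)).det :=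
    StubMatrixAffinePathCalculus.eventually_isUnit_det_sub_smul (J₁ * Pm) hE₁u
  obtain ⟨L, R, hLR⟩ := exists_prod_map_ite_eq M₂ ht₁T
  refine ((hP'.fun_mul hQ').congr_of_eventuallyEq ?_).congr_deriv ?_
  · -- near `0` the inner derivative IS the product of the two paths (layer F1)
    filter_upwards [hev] with s hs
    exact (key s hs).deriv
  · -- the value of the derivative
    have htarget : ((List.range T).map fun i : ℕ =>
        (if (i : ZMod T) = t₁ then dGamma (Matrix.reindex e e Z) - c • (1 : Matrix (Finset (Fin d)) (Finset (Fin d)) ℂ)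
          else 1) * ((if (i : ZMod T) = t₂ then I₂ else 1) * Mf i)) =
        (List.range T).map fun i => if i = t₁.val then
          (dGamma (Matrix.reindex e e Z) - c • (1 : Matrix (Finset (Fin d)) (Finset (Fin d)) ℂ)) * Mf t₁.val
          else M₂ i := by
      refine List.map_congr_left fun i hi => ?_
      rw [List.mem_range] at hi
      by_cases h : i = t₁.val
      · rw [if_pos h, if_pos ((natCast_eq_iff hi t₁).2 h), (natCast_eq_iff hi t₁).2 h, if_neg h12,
          Matrix.one_mul, h]
      · rw [if_neg h, if_neg (mt (natCast_eq_iff hi t₁).1 h), Matrix.one_mul]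
    simp only [FockLiftPosDef.fockLift_eq_Gamma', hMf']
    rw [htarget, hLR, hLR, Complex.ofReal_zero, zero_smul, sub_zero, hγ0', hLR, hM₂t₁, Matrix.sub_mul,
      Matrix.smul_mul, Matrix.one_mul, Matrix.mul_sub, Matrix.sub_mul, Matrix.mul_smul, Matrix.smul_mul,
      supertrace_sub_smul, ← hPE, htr]
    ring

end Summit.QuantumFields.QCD.Cruxes.RobustYangMillsHandover.PinTheInfimum
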